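import Literature.MathematicalPhysics.QuantumFieldTheory.Balaban1983to89.T3CruxEstimates
import Literature.MathematicalPhysics.QuantumFieldTheory.Balaban1983to89.T3DescentFibreTower
import Literature.MathematicalPhysics.QuantumFieldTheory.Balaban1983to89.T3OneStepAveragingPlaquettes

/-!
# Route `UnitScaleTilt` — crux K1bR-pr `FluctuationComparisonRegPr` (stmt-QuantumFields-19201), stub `stub_logComparisonRegPr`,
# layer S-A «ONE TOWER»: run `K+1`'s restricted height density IS run `K`'s Radon–Nikodym tower applied to the ONE-STEP
# RENORMALISED WEIGHT (support file `--supports stmt-QuantumFields-19201`; the stub stays open)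

Fleet lead `ym-ust-19201-p2` (gen 0); split card `CARD-19201-logComparison-split.md` (evidence #16 on the item), sub-lemma S-A.
WHAT THIS IS NOT: no estimate of Bałaban's; pure measure theory over the published formulas (2)/(6)/(7) of [Balaban1985UV3] and the
level identifications of the tree (`T3LevelShift.fieldShift`).  It is the normal form of [King1986] §3.2 p.656 («by applying the
renormalization transformation k and k + n times respectively we generate two models on the same unit lattice») for the two CONSECUTIVE
cut-offs `K`, `K+1` of the registered stub, at the comparison height `K − n`:

* §1 the height density of run `K`'s tower started from an ARBITRARY initial density `ρ₀` on the finest lattice of the `K`-th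
  approximation, `V ↦ towerDensity F K ρ₀ (K − n) (fieldShift V)` read on `(F.P n)₀` (no new definition is introduced — the expression is
  spelled out; write `w_K`, `ρ^{ρ₀}` below for readability only); run `K`'s restricted height density is the case `ρ₀ = 1_S·e^{−β_K A}`
  (`heightDensity_eq_towerDensity`, definitional); the push-forward identity with a test function (`integral_towerHeight_mul`:
  `∫ ρ^{ρ₀}(V) g(V) dV^{(n)} = ∫ ρ₀(U) g(D_{n,K}U) dU`; `integral_heightDensity_mul`).
* §2 the ONE-STEP RENORMALISED WEIGHT `w_K(U) := T₀^{(K+1)}(1_{PlaqSmall θ(K+1)}·e^{−β_{K+1}A})(e₀⁻¹U) = resDensity F γ (K+1) {PlaqSmall θ(K+1)} 1 (e₀⁻¹U)`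
  read on `(F.P K)₀` through the level identification `e₀ : (F.P (K+1))₁ ≃ (F.P K)₀`: non-negative, measurable, integrable; EVENT PEELING
  `histGood_succ` (`histGood (K+1) n = {PlaqSmall θ(K+1)} ∩ (e₀ ∘ avg₀)⁻¹(histGood K n)`) and DESCENT PEELING `descendTo_succ_eq`
  (`D_{n,K+1} = D_{n,K} ∘ e₀ ∘ avg₀`).
* §3 **`heightDensity_succ_ae_eq`**: for a.e. `V ∂ dV^{(n)}`,
  `heightDensity F γ _ (histGood F ℰp θ (K+1) n) V = towerDensity F K (1_{histGood K n}·w_K) (K − n) (fieldShift V)`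
  — both runs are ONE tower on ONE lattice family with the two initial densities `1_S·e^{−β_K A}` and `1_S·w_K`, `S = histGood K n`
  (uniqueness of densities: both sides integrate every bounded measurable test `g` to `∫_{histGood (K+1) n} e^{−β_{K+1}A(U′)} g(D_{n,K+1}U′) dU′`,
  `integral_heightDensity_succ_mul_eq`); and the a.e.-rewriting of the registered stub's two-run clause (`stub_clause_iff_oneTower`).

References: C. King, CMP 102 (1986) 649–677 [King1986] (§3.2 p.656, Thm 3.4 (3.9)); T. Bałaban, CMP 102 (1985) 255–275 [Balaban1985UV3]
((2) p.256, (6)–(7) p.257, (41) p.266); CMP 98 (1985) 17–51 [Balaban1985Averaging] ((10) p.19).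
-/

noncomputable section

open MeasureTheory Filter Topology
open Literature.MathematicalPhysics.QuantumFieldTheory.Balaban1983to89
open Literature.MathematicalPhysics.QuantumFieldTheory.Balaban1983to89.T3ContinuumYM3Torus
open Literature.MathematicalPhysics.QuantumFieldTheory.Balaban1983to89.T3LevelShift
open Literature.MathematicalPhysics.QuantumFieldTheory.Balaban1983to89.T3UnitLawDensityEML (ℰp measurableE_ℰp)
open Literature.MathematicalPhysics.QuantumFieldTheory.Balaban1983to89.T3UnitScaleTilt
open Literature.MathematicalPhysics.QuantumFieldTheory.Balaban1983to89.T3RestrictedUnitDensity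
open Literature.MathematicalPhysics.QuantumFieldTheory.Balaban1983to89.T3TiltDescent
open Literature.MathematicalPhysics.QuantumFieldTheory.Balaban1983to89.T3DescentFibreTower
open Literature.MathematicalPhysics.QuantumFieldTheory.Balaban1983to89.T3CruxEstimates
open Literature.MathematicalPhysics.QuantumFieldTheory.Balaban1983to89.T3OneStepAveragingPlaquettes
open Literature.MathematicalPhysics.QuantumFieldTheory.Balaban1983to89.Missing
open Literature.MathematicalPhysics.QuantumFieldTheory.Balaban1983to89.T4Continuum

namespace Summit.QuantumFields.YangMills.Theorems.LogComparisonOneTower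

/-! ## §0 A.e. bookkeeping -/

/-- A.e.-equal functions may be exchanged inside an a.e. clause (local helper). [folklore] -/
theorem ae_iff_of_ae_eq {X : Type*} [MeasurableSpace X] {μ : Measure X} {f g : X → ℝ} (h : f =ᵐ[μ] g) (P : X → ℝ → Prop) :
    (∀ᵐ x ∂μ, P x (f x)) ↔ (∀ᵐ x ∂μ, P x (g x)) :=
  ⟨fun hf => by filter_upwards [hf, h] with x hx hfg; rwa [← hfg], fun hg => by filter_upwards [hg, h] with x hx hfg; rwa [hfg]⟩

/-- A set integral is the integral against the indicator test function (local helper). [folklore] -/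
theorem setIntegral_eq_integral_mul_indicator_one {X : Type*} [MeasurableSpace X] (μ : Measure X) {s : Set X}
    (hs : MeasurableSet s) (f : X → ℝ) : ∫ x in s, f x ∂μ = ∫ x, f x * s.indicator (fun _ => (1 : ℝ)) x ∂μ := by
  rw [← integral_indicator hs]
  congr 1
  funext x
  by_cases hx : x ∈ s <;> simp [hx]

/-! ## §1 Height densities of the tower from an arbitrary initial density -/

section From

variable (F : T3Family) (K : ℕ) (ρ₀ : Density (F.P K) 0 (Matrix.specialUnitaryGroup (Fin 2) ℂ)) {n : ℕ} (hK : n ≤ K)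

/-- **RUN `K`'s RESTRICTED HEIGHT DENSITY IS ITS RADON–NIKODYM TOWER FROM `1_S·e^{−β_K A}`, READ ON THE COMPARISON LATTICE**
(definitional unfolding of the tree's `heightDensity`/`resDensity`; the one-tower normal form below puts run `K+1` in the same shape with
another initial density). [cite: Balaban1985UV3, (2) p.256 and (7) p.257] -/
theorem heightDensity_eq_towerDensity (γ : ℝ) (S : Set (GaugeField (F.P K) 0 (Matrix.specialUnitaryGroup (Fin 2) ℂ)))
    (V : GaugeField (F.P n) 0 (Matrix.specialUnitaryGroup (Fin 2) ℂ)) :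
    heightDensity F γ hK S V = towerDensity F K (S.indicator (boltzmann (F.P K) ((F.scheme ℰp γ).β K))) (K - n)
      (fieldShift (F.sitesPerDir_eq (m := F.m) (K := K) (j := K - n) (m' := F.m) (K' := n) (j' := 0) (by omega)) V) :=
  rfl

variable {ρ₀}

/-- The tower's height density `V ↦ ρ^{ρ₀}_{K−n}(fieldShift V)` from an arbitrary initial density `ρ₀ ≥ 0` is non-negative. [cite: Balaban1985UV3, (2) p.256] -/
theorem towerHeight_nonneg (h0 : ∀ U, 0 ≤ ρ₀ U) (V : GaugeField (F.P n) 0 (Matrix.specialUnitaryGroup (Fin 2) ℂ)) :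
    0 ≤ towerDensity F K ρ₀ (K - n)
      (fieldShift (F.sitesPerDir_eq (m := F.m) (K := K) (j := K - n) (m' := F.m) (K' := n) (j' := 0) (by omega)) V) :=
  towerDensity_nonneg F K h0 _ _

/-- … measurable for `ρ₀ ≥ 0` measurable. [cite: Balaban1985UV3, (2) p.256] -/
theorem measurable_towerHeight (h0 : ∀ U, 0 ≤ ρ₀ U) (hm : Measurable ρ₀) :
    Measurable fun V : GaugeField (F.P n) 0 (Matrix.specialUnitaryGroup (Fin 2) ℂ) => towerDensity F K ρ₀ (K - n)
      (fieldShift (F.sitesPerDir_eq (m := F.m) (K := K) (j := K - n) (m' := F.m) (K' := n) (j' := 0) (by omega)) V) :=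
  (measurable_towerDensity F K h0 hm (K - n)).comp (measurable_fieldShift _)

/-- … integrable for `ρ₀` integrable (the level identification preserves product Haar measure). [cite: Balaban1985UV3, (6) p.257] -/
theorem integrable_towerHeight
    (hi : Integrable ρ₀ (fieldMeasure (F.P K) 0 (Matrix.specialUnitaryGroup (Fin 2) ℂ))) :
    Integrable (fun V : GaugeField (F.P n) 0 (Matrix.specialUnitaryGroup (Fin 2) ℂ) => towerDensity F K ρ₀ (K - n)
      (fieldShift (F.sitesPerDir_eq (m := F.m) (K := K) (j := K - n) (m' := F.m) (K' := n) (j' := 0) (by omega)) V))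
      (fieldMeasure (F.P n) 0 (Matrix.specialUnitaryGroup (Fin 2) ℂ)) :=
  (measurePreserving_fieldShift _).integrable_comp_of_integrable (integrable_towerDensity F K hi (K - n) (by omega))

/-- **THE PUSH-FORWARD IDENTITY AT THE COMPARISON HEIGHT, ARBITRARY INITIAL DENSITY**: `∫ ρ^{ρ₀}_{K−n}(fieldShift V)·g(V) dV^{(n)} =
∫ ρ₀(U)·g(D_{n,K}U) dU` for bounded measurable `g` ([Balaban1985Averaging] (10) iterated `K − n` times, read through the measure-preserving
level identification; `D_{n,K}` = `T3TiltDescent.descendTo`). [cite: Balaban1985Averaging, (10) p.19] -/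
theorem integral_towerHeight_mul
    (hi : Integrable ρ₀ (fieldMeasure (F.P K) 0 (Matrix.specialUnitaryGroup (Fin 2) ℂ)))
    (g : GaugeField (F.P n) 0 (Matrix.specialUnitaryGroup (Fin 2) ℂ) → ℝ) (hg : Measurable g) (hC : ∃ C : ℝ, ∀ V, |g V| ≤ C) :
    ∫ V, towerDensity F K ρ₀ (K - n)
          (fieldShift (F.sitesPerDir_eq (m := F.m) (K := K) (j := K - n) (m' := F.m) (K' := n) (j' := 0) (by omega)) V) * g V
        ∂fieldMeasure (F.P n) 0 (Matrix.specialUnitaryGroup (Fin 2) ℂ) =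
      ∫ U, ρ₀ U * g (descendTo F ℰp n K hK U) ∂fieldMeasure (F.P K) 0 (Matrix.specialUnitaryGroup (Fin 2) ℂ) := by
  obtain ⟨C, hC⟩ := hC
  -- the downward identification `(F.P K)_{K−n} → (F.P n)₀` and its inverse
  have hdn := F.sitesPerDir_eq (m := F.m) (K := n) (j := 0) (m' := F.m) (K' := K) (j' := K - n) (by omega)
  have hup := F.sitesPerDir_eq (m := F.m) (K := K) (j := K - n) (m' := F.m) (K' := n) (j' := 0) (by omega)
  have hid : ∀ V : GaugeField (F.P n) 0 (Matrix.specialUnitaryGroup (Fin 2) ℂ), fieldShift hdn (fieldShift hup V) = V := fun V => by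
    rw [fieldShift_fieldShift, fieldShift_refl]
  calc ∫ V, towerDensity F K ρ₀ (K - n) (fieldShift hup V) * g V ∂fieldMeasure (F.P n) 0 (Matrix.specialUnitaryGroup (Fin 2) ℂ)
      = ∫ V, (fun W => towerDensity F K ρ₀ (K - n) W * g (fieldShift hdn W)) (fieldShift hup V)
          ∂fieldMeasure (F.P n) 0 (Matrix.specialUnitaryGroup (Fin 2) ℂ) := by
        refine integral_congr_ae (Eventually.of_forall fun V => ?_)
        show towerDensity F K ρ₀ (K - n) (fieldShift hup V) * g V = towerDensity F K ρ₀ (K - n) (fieldShift hup V) * g _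
        rw [hid]
    _ = ∫ W, towerDensity F K ρ₀ (K - n) W * g (fieldShift hdn W)
          ∂fieldMeasure (F.P K) (K - n) (Matrix.specialUnitaryGroup (Fin 2) ℂ) := by
        exact integral_comp_fieldShift (G := Matrix.specialUnitaryGroup (Fin 2) ℂ) hup
          (fun W => towerDensity F K ρ₀ (K - n) W * g (fieldShift hdn W))
    _ = ∫ U, ρ₀ U * g (fieldShift hdn (Averaging.iter (fun j => BlockAveraging.blockAvg (P := F.P K) (j := j) ℰp) (K - n) U))
          ∂fieldMeasure (F.P K) 0 (Matrix.specialUnitaryGroup (Fin 2) ℂ) :=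
        integral_towerDensity_mul F K hi (K - n) (by omega) _ (hg.comp (measurable_fieldShift _)) ⟨C, fun W => hC _⟩
    _ = _ := rfl

/-- The same identity for run `K`'s restricted height density: `∫ heightDensity·g dV^{(n)} = ∫_S e^{−β_K A(U)} g(D_{n,K}U) dU`
(= `T3TiltDescent.integral_map_descendTo_restrict` without the partition function). [cite: Balaban1985UV3, (2) p.256 and (6) p.257] -/
theorem integral_heightDensity_mul {γ : ℝ} (hγ : 0 ≤ γ) {S : Set (GaugeField (F.P K) 0 (Matrix.specialUnitaryGroup (Fin 2) ℂ))}
    (hS : MeasurableSet S)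
    (g : GaugeField (F.P n) 0 (Matrix.specialUnitaryGroup (Fin 2) ℂ) → ℝ) (hg : Measurable g) (hC : ∃ C : ℝ, ∀ V, |g V| ≤ C) :
    ∫ V, heightDensity F γ hK S V * g V ∂fieldMeasure (F.P n) 0 (Matrix.specialUnitaryGroup (Fin 2) ℂ) =
      ∫ U, S.indicator (boltzmann (F.P K) ((F.scheme ℰp γ).β K)) U * g (descendTo F ℰp n K hK U)
        ∂fieldMeasure (F.P K) 0 (Matrix.specialUnitaryGroup (Fin 2) ℂ) :=
  integral_towerHeight_mul F K hK
    ((integrable_boltzmann RegularGaugeGroup.measurable_reTr _ (F.scheme_β_nonneg ℰp hγ K)).indicator hS) g hg hC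

end From

/-! ## §2 The one-step renormalised weight of run `K+1`, event peeling and descent peeling -/

section OneStep

variable (F : T3Family)

variable (γ : ℝ) (K : ℕ) (θ : ℕ → ℝ)

/-- **THE ONE-STEP RENORMALISED WEIGHT OF RUN `K+1` READ ON RUN `K`'s FINEST LATTICE** —
`w_K(U) := T₀^{(K+1)}(1_{PlaqSmall θ(K+1)}·e^{−β_{K+1}A})(e₀⁻¹U) = resDensity F γ (K+1) {PlaqSmall θ(K+1)} 1 (e₀⁻¹U)`, the first renormalisation
transformation of the `(K+1)`-th approximation applied to its Boltzmann weight restricted to the finest small-field event, at the level-1 field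
identified with `U` ([King1986] §3.2's «model on the same lattice» after one more step) — is NON-NEGATIVE. [cite: King1986, §3.2 p.656] -/
theorem oneStepWeight_nonneg (U : GaugeField (F.P K) 0 (Matrix.specialUnitaryGroup (Fin 2) ℂ)) :
    0 ≤ resDensity F γ (K + 1) {U' | PlaqSmall (θ (K + 1)) U'} 1
            (fieldShift (F.sitesPerDir_eq (m := F.m) (K := K + 1) (j := 1) (m' := F.m) (K' := K) (j' := 0) (by omega)) U) :=
  resDensity_nonneg F γ (K + 1) _ 1 _

/-- `w_K` is measurable. [cite: Balaban1985UV3, (2) p.256] -/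
theorem measurable_oneStepWeight :
    Measurable fun U : GaugeField (F.P K) 0 (Matrix.specialUnitaryGroup (Fin 2) ℂ) =>
      resDensity F γ (K + 1) {U' | PlaqSmall (θ (K + 1)) U'} 1
            (fieldShift (F.sitesPerDir_eq (m := F.m) (K := K + 1) (j := 1) (m' := F.m) (K' := K) (j' := 0) (by omega)) U) :=
  (measurable_resDensity F γ (K + 1) (measurableSet_plaqSmall _) 1).comp (measurable_fieldShift _)

variable {γ}

/-- `w_K` is integrable for product Haar measure on `(F.P K)₀` (`γ ≥ 0`). [cite: Balaban1985UV3, (6) p.257] -/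
theorem integrable_oneStepWeight (hγ : 0 ≤ γ) :
    Integrable (fun U : GaugeField (F.P K) 0 (Matrix.specialUnitaryGroup (Fin 2) ℂ) =>
      resDensity F γ (K + 1) {U' | PlaqSmall (θ (K + 1)) U'} 1
            (fieldShift (F.sitesPerDir_eq (m := F.m) (K := K + 1) (j := 1) (m' := F.m) (K' := K) (j' := 0) (by omega)) U))
      (fieldMeasure (F.P K) 0 (Matrix.specialUnitaryGroup (Fin 2) ℂ)) :=
  (measurePreserving_fieldShift _).integrable_comp_of_integrable
    (integrable_resDensity F (K + 1) (measurableSet_plaqSmall _) hγ (k := 1) (by omega))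

/-- `1_S·w_K` is integrable for measurable `S` (`γ ≥ 0`). [cite: Balaban1985UV3, (6) p.257] -/
theorem integrable_indicator_oneStepWeight (hγ : 0 ≤ γ) {S : Set (GaugeField (F.P K) 0 (Matrix.specialUnitaryGroup (Fin 2) ℂ))}
    (hS : MeasurableSet S) :
    Integrable (S.indicator fun U : GaugeField (F.P K) 0 (Matrix.specialUnitaryGroup (Fin 2) ℂ) =>
      resDensity F γ (K + 1) {U' | PlaqSmall (θ (K + 1)) U'} 1
            (fieldShift (F.sitesPerDir_eq (m := F.m) (K := K + 1) (j := 1) (m' := F.m) (K' := K) (j' := 0) (by omega)) U))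
      (fieldMeasure (F.P K) 0 (Matrix.specialUnitaryGroup (Fin 2) ℂ)) :=
  (integrable_oneStepWeight F K θ hγ).indicator hS

variable (γ) {G : Type*} [GaugeGroup G] (ℰ : LoopAverage G)

/-- **DESCENT PEELS THE FIRST STEP**: `D_{n,K+1}U′ = D_{n,K}(e₀(avg₀ U′))` — averaging `K + 1 − n` times on the `(K+1)`-th tower is one (0.4)
averaging, the identification `e₀ : (F.P (K+1))₁ ≃ (F.P K)₀`, then `K − n` averagings on the `K`-th tower (`descendTo_descendTo` + `descendTo_succ`).
[cite: Balaban1987RG1, (0.11) p.253] -/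
theorem descendTo_succ_eq {n : ℕ} (hK : n ≤ K) (U' : GaugeField (F.P (K + 1)) 0 G) :
    descendTo F ℰ n (K + 1) (hK.trans (Nat.le_succ K)) U' =
      descendTo F ℰ n K hK (fieldShift (F.sitesPerDir_eq (m := F.m) (K := K) (j := 0) (m' := F.m) (K' := K + 1) (j' := 1) (by omega)) ((BlockAveraging.blockAvg (P := F.P (K + 1)) (j := 0) ℰ).avg U')) := by
  rw [← descendTo_descendTo F ℰ hK (Nat.le_succ K) U', descendTo_succ]
  rfl

/-- The `(1 + j)`-fold averaging of run `K+1`, read on run `K`'s tower at level `j`, is the `j`-fold averaging there of `e₀(avg₀ U′)`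
(`iter_add` + `iterFrom_fieldShift`). [cite: Balaban1987RG1, (0.11) p.253] -/
theorem fieldShift_iter_one_add (j : ℕ) (U' : GaugeField (F.P (K + 1)) 0 G) :
    fieldShift (F.sitesPerDir_eq (m := F.m) (K := K) (j := j) (m' := F.m) (K' := K + 1) (j' := 1 + j) (by omega))
        (Averaging.iter (fun i => BlockAveraging.blockAvg (P := F.P (K + 1)) (j := i) ℰ) (1 + j) U') =
      Averaging.iter (fun i => BlockAveraging.blockAvg (P := F.P K) (j := i) ℰ) j
        (fieldShift (F.sitesPerDir_eq (m := F.m) (K := K) (j := 0) (m' := F.m) (K' := K + 1) (j' := 1) (by omega)) ((BlockAveraging.blockAvg (P := F.P (K + 1)) (j := 0) ℰ).avg U')) := by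
  rw [T4AvgSensitivity.iter_add]
  exact iterFrom_fieldShift ℰ (show F.m + (K + 1) = F.m + K + 1 by omega) j _

/-- **EVENT PEELING**: run `K+1`'s UV-small history with `n` free top steps is its finest small-field event intersected with the pull-back,
along one averaging and the identification `e₀`, of run `K`'s UV-small history with the same `n` (`n ≤ K`; thresholds by distance from the unit
scale, so the constrained heights match). [cite: Balaban1985UV3, (7) p.257] -/
theorem histGood_succ {n : ℕ} (hK : n ≤ K) :
    histGood F ℰp θ (K + 1) n =
      {U' | PlaqSmall (θ (K + 1)) U'} ∩
        (fun U' => fieldShift (F.sitesPerDir_eq (m := F.m) (K := K) (j := 0) (m' := F.m) (K' := K + 1) (j' := 1) (by omega)) ((BlockAveraging.blockAvg (P := F.P (K + 1)) (j := 0) ℰp).avg U')) ⁻¹'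
          histGood F ℰp θ K n := by
  ext U'
  simp only [histGood, Set.mem_inter_iff, Set.mem_setOf_eq, Set.mem_preimage]
  constructor
  · intro hU
    refine ⟨hU 0 (by omega), fun j hj => ?_⟩
    have h1 := hU (1 + j) (by omega)
    rw [show K + 1 - (1 + j) = K - j by omega] at h1
    rw [← fieldShift_iter_one_add F K ℰp j U']
    exact (plaqSmall_fieldShift F _ _ _).mpr h1
  · rintro ⟨h0, hU⟩ j hj
    by_cases hj0 : j = 0
    · subst hj0
      exact h0
    · obtain ⟨i, rfl⟩ : ∃ i, j = 1 + i := ⟨j - 1, by omega⟩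
      have h1 := hU i (by omega)
      rw [← fieldShift_iter_one_add F K ℰp i U'] at h1
      rw [show K + 1 - (1 + i) = K - i by omega]
      exact (plaqSmall_fieldShift F _ _ _).mp h1

end OneStep

/-! ## §3 The one-tower normal form of the two consecutive runs -/

section Main

variable (F : T3Family) {γ : ℝ} (hγ : 0 ≤ γ) (K : ℕ) (θ : ℕ → ℝ) {n : ℕ} (hK : n ≤ K)

include hγ

/-- **BOTH SIDES INTEGRATE EVERY BOUNDED MEASURABLE TEST FUNCTION TO THE SAME NUMBER**: for run `K+1`'s restricted height density on
`histGood (K+1) n` and for run `K`'s tower applied to `1_{histGood K n}·w_K`, `∫ (·)·g dV^{(n)} = ∫_{histGood (K+1) n} e^{−β_{K+1}A(U′)} g(D_{n,K+1}U′) dU′`.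
[cite: Balaban1985UV3, (2) p.256 and (6)-(7) p.257] -/
theorem integral_heightDensity_succ_mul_eq (g : GaugeField (F.P n) 0 (Matrix.specialUnitaryGroup (Fin 2) ℂ) → ℝ) (hg : Measurable g)
    (hC : ∃ C : ℝ, ∀ V, |g V| ≤ C) :
    ∫ V, heightDensity F γ (hK.trans (Nat.le_succ K)) (histGood F ℰp θ (K + 1) n) V * g V
        ∂fieldMeasure (F.P n) 0 (Matrix.specialUnitaryGroup (Fin 2) ℂ) =
      ∫ V, towerDensity F K ((histGood F ℰp θ K n).indicator (fun U => resDensity F γ (K + 1) {U' | PlaqSmall (θ (K + 1)) U'} 1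
            (fieldShift (F.sitesPerDir_eq (m := F.m) (K := K + 1) (j := 1) (m' := F.m) (K' := K) (j' := 0) (by omega)) U))) (K - n)
          (fieldShift (F.sitesPerDir_eq (m := F.m) (K := K) (j := K - n) (m' := F.m) (K' := n) (j' := 0) (by omega)) V) * g V
        ∂fieldMeasure (F.P n) 0 (Matrix.specialUnitaryGroup (Fin 2) ℂ) := by
  obtain ⟨C, hC⟩ := hC
  have hS := measurableSet_histGood F ℰp measurableE_ℰp θ K n
  have hS' := measurableSet_histGood F ℰp measurableE_ℰp θ (K + 1) n
  have hsm : MeasurableSet {U' : GaugeField (F.P (K + 1)) 0 (Matrix.specialUnitaryGroup (Fin 2) ℂ) | PlaqSmall (θ (K + 1)) U'} :=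
    measurableSet_plaqSmall _
  -- the identification `e₀ : (F.P (K+1))₁ → (F.P K)₀` and its inverse
  set e₀ : GaugeField (F.P (K + 1)) 1 (Matrix.specialUnitaryGroup (Fin 2) ℂ) → GaugeField (F.P K) 0 (Matrix.specialUnitaryGroup (Fin 2) ℂ) :=
    fieldShift (F.sitesPerDir_eq (m := F.m) (K := K) (j := 0) (m' := F.m) (K' := K + 1) (j' := 1) (by omega))
  have he : Measurable e₀ := measurable_fieldShift _
  have hD : Measurable (descendTo F ℰp n K hK : GaugeField (F.P K) 0 (Matrix.specialUnitaryGroup (Fin 2) ℂ) → _) :=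
    measurable_descendTo F ℰp measurableE_ℰp hK
  -- left-hand side: run `K+1`'s push-forward identity
  rw [integral_heightDensity_mul F (K + 1) (hK.trans (Nat.le_succ K)) hγ hS' g hg ⟨C, hC⟩,
    integral_towerHeight_mul F K hK (integrable_indicator_oneStepWeight F K θ hγ hS) g hg ⟨C, hC⟩]
  -- right-hand side: undo the identification `e₀`, then run `K+1`'s FIRST-STEP push-forward identity
  have hH : Measurable fun V₁ : GaugeField (F.P (K + 1)) 1 (Matrix.specialUnitaryGroup (Fin 2) ℂ) =>
      (histGood F ℰp θ K n).indicator (fun _ => (1 : ℝ)) (e₀ V₁) * g (descendTo F ℰp n K hK (e₀ V₁)) :=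
    ((measurable_const.indicator hS).comp he).mul (hg.comp (hD.comp he))
  have hHC : ∃ C' : ℝ, ∀ V₁ : GaugeField (F.P (K + 1)) 1 (Matrix.specialUnitaryGroup (Fin 2) ℂ),
      |(histGood F ℰp θ K n).indicator (fun _ => (1 : ℝ)) (e₀ V₁) * g (descendTo F ℰp n K hK (e₀ V₁))| ≤ C' := by
    refine ⟨C, fun V₁ => ?_⟩
    rw [abs_mul]
    have h1 : |(histGood F ℰp θ K n).indicator (fun _ => (1 : ℝ)) (e₀ V₁)| ≤ 1 := by
      by_cases hm : e₀ V₁ ∈ histGood F ℰp θ K n <;> simp [hm]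
    have hC0 : 0 ≤ C := (abs_nonneg _).trans (hC (descendTo F ℰp n K hK (e₀ V₁)))
    calc _ ≤ 1 * C := mul_le_mul h1 (hC _) (abs_nonneg _) zero_le_one
      _ = C := one_mul C
  have hrhs : ∫ U, (histGood F ℰp θ K n).indicator (fun U => resDensity F γ (K + 1) {U' | PlaqSmall (θ (K + 1)) U'} 1
            (fieldShift (F.sitesPerDir_eq (m := F.m) (K := K + 1) (j := 1) (m' := F.m) (K' := K) (j' := 0) (by omega)) U)) U * g (descendTo F ℰp n K hK U)
        ∂fieldMeasure (F.P K) 0 (Matrix.specialUnitaryGroup (Fin 2) ℂ) =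
      ∫ V₁, resDensity F γ (K + 1) {U' | PlaqSmall (θ (K + 1)) U'} 1 V₁ *
          ((histGood F ℰp θ K n).indicator (fun _ => (1 : ℝ)) (e₀ V₁) * g (descendTo F ℰp n K hK (e₀ V₁)))
        ∂fieldMeasure (F.P (K + 1)) 1 (Matrix.specialUnitaryGroup (Fin 2) ℂ) := by
    have hcv := integral_comp_fieldShift (G := Matrix.specialUnitaryGroup (Fin 2) ℂ) (F.sitesPerDir_eq (m := F.m) (K := K) (j := 0) (m' := F.m) (K' := K + 1) (j' := 1) (by omega))
      (fun U => (histGood F ℰp θ K n).indicator (fun U => resDensity F γ (K + 1) {U' | PlaqSmall (θ (K + 1)) U'} 1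
            (fieldShift (F.sitesPerDir_eq (m := F.m) (K := K + 1) (j := 1) (m' := F.m) (K' := K) (j' := 0) (by omega)) U)) U * g (descendTo F ℰp n K hK U))
    refine hcv.symm.trans (integral_congr_ae (Eventually.of_forall fun V₁ => ?_))
    show (histGood F ℰp θ K n).indicator (fun U => resDensity F γ (K + 1) {U' | PlaqSmall (θ (K + 1)) U'} 1
            (fieldShift (F.sitesPerDir_eq (m := F.m) (K := K + 1) (j := 1) (m' := F.m) (K' := K) (j' := 0) (by omega)) U)) (e₀ V₁) * g (descendTo F ℰp n K hK (e₀ V₁)) =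
      resDensity F γ (K + 1) {U' | PlaqSmall (θ (K + 1)) U'} 1 V₁ *
        ((histGood F ℰp θ K n).indicator (fun _ => (1 : ℝ)) (e₀ V₁) * g (descendTo F ℰp n K hK (e₀ V₁)))
    have hw : resDensity F γ (K + 1) {U' | PlaqSmall (θ (K + 1)) U'} 1
        (fieldShift (F.sitesPerDir_eq (m := F.m) (K := K + 1) (j := 1) (m' := F.m) (K' := K) (j' := 0) (by omega)) (e₀ V₁)) =
        resDensity F γ (K + 1) {U' | PlaqSmall (θ (K + 1)) U'} 1 V₁ := by
      show resDensity F γ (K + 1) _ 1 (fieldShift _ (fieldShift _ V₁)) = _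
      rw [fieldShift_fieldShift, fieldShift_refl]
    by_cases hm : e₀ V₁ ∈ histGood F ℰp θ K n
    · rw [Set.indicator_of_mem hm, Set.indicator_of_mem hm, hw, one_mul]
    · rw [Set.indicator_of_notMem hm, Set.indicator_of_notMem hm, zero_mul, mul_zero]
  rw [hrhs, integral_resDensity_mul F (K + 1) hsm hγ (k := 1) (by omega) _ hH hHC]
  -- compare the two integrands on `(F.P (K+1))₀` pointwise: event peeling and descent peeling
  refine integral_congr_ae (Eventually.of_forall fun U' => ?_)
  have hpeel := histGood_succ F K θ hK
  have hdesc := descendTo_succ_eq F K ℰp hK U'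
  show (histGood F ℰp θ (K + 1) n).indicator (boltzmann (F.P (K + 1)) ((F.scheme ℰp γ).β (K + 1))) U' *
      g (descendTo F ℰp n (K + 1) _ U') =
    {U' | PlaqSmall (θ (K + 1)) U'}.indicator (boltzmann (F.P (K + 1)) ((F.scheme ℰp γ).β (K + 1))) U' *
      ((histGood F ℰp θ K n).indicator (fun _ => (1 : ℝ))
          (e₀ ((BlockAveraging.blockAvg (P := F.P (K + 1)) (j := 0) ℰp).avg U')) *
        g (descendTo F ℰp n K hK (e₀ ((BlockAveraging.blockAvg (P := F.P (K + 1)) (j := 0) ℰp).avg U'))))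
  rw [hdesc]
  by_cases h1 : U' ∈ histGood F ℰp θ (K + 1) n
  · have h1' := h1
    rw [hpeel] at h1'
    have h2' : e₀ ((BlockAveraging.blockAvg (P := F.P (K + 1)) (j := 0) ℰp).avg U') ∈ histGood F ℰp θ K n := h1'.2
    rw [Set.indicator_of_mem h1, Set.indicator_of_mem h1'.1, Set.indicator_of_mem h2', one_mul]
  · rw [Set.indicator_of_notMem h1, zero_mul]
    by_cases h2 : PlaqSmall (θ (K + 1)) U'
    · have h3 : e₀ ((BlockAveraging.blockAvg (P := F.P (K + 1)) (j := 0) ℰp).avg U') ∉ histGood F ℰp θ K n := by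
        intro h3
        exact h1 (by rw [hpeel]; exact ⟨h2, h3⟩)
      rw [Set.indicator_of_notMem h3, zero_mul, mul_zero]
    · rw [Set.indicator_of_notMem (show U' ∉ {U' | PlaqSmall (θ (K + 1)) U'} from h2), zero_mul]

/-- **THE ONE-TOWER NORMAL FORM (S-A)**: for a.e. datum `V` on the comparison lattice, run `K+1`'s restricted height density on its UV-small
history with `n` free top steps EQUALS run `K`'s Radon–Nikodym tower applied to the initial density `1_{histGood K n}·w_K`, read at the same
height — both runs are one tower on one lattice family, started from `1_S·e^{−β_K A}` and `1_S·w_K` respectively ([King1986] §3.2: «two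
models on the same unit lattice»; here at the last constrained height instead of the unit lattice). [cite: King1986, §3.2 p.656] -/
theorem heightDensity_succ_ae_eq :
    heightDensity F γ (hK.trans (Nat.le_succ K)) (histGood F ℰp θ (K + 1) n) =ᵐ[fieldMeasure (F.P n) 0 (Matrix.specialUnitaryGroup (Fin 2) ℂ)]
      fun V => towerDensity F K ((histGood F ℰp θ K n).indicator (fun U => resDensity F γ (K + 1) {U' | PlaqSmall (θ (K + 1)) U'} 1
            (fieldShift (F.sitesPerDir_eq (m := F.m) (K := K + 1) (j := 1) (m' := F.m) (K' := K) (j' := 0) (by omega)) U))) (K - n)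
          (fieldShift (F.sitesPerDir_eq (m := F.m) (K := K) (j := K - n) (m' := F.m) (K' := n) (j' := 0) (by omega)) V) := by
  have hS := measurableSet_histGood F ℰp measurableE_ℰp θ K n
  have hS' := measurableSet_histGood F ℰp measurableE_ℰp θ (K + 1) n
  have hi₁ := (heightDensity_props F (hK.trans (Nat.le_succ K)) hS' hγ).2
  have hi₂ := integrable_towerHeight F K hK (integrable_indicator_oneStepWeight F K θ hγ hS)
  refine hi₁.ae_eq_of_forall_setIntegral_eq _ _ hi₂ fun s hs _ => ?_
  have hb : ∃ C : ℝ, ∀ V : GaugeField (F.P n) 0 (Matrix.specialUnitaryGroup (Fin 2) ℂ), |s.indicator (fun _ => (1 : ℝ)) V| ≤ C :=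
    ⟨1, fun V => by by_cases hV : V ∈ s <;> simp [hV]⟩
  rw [setIntegral_eq_integral_mul_indicator_one _ hs, setIntegral_eq_integral_mul_indicator_one _ hs]
  exact integral_heightDensity_succ_mul_eq F hγ K θ hK _ (measurable_const.indicator hs) hb

/-- **THE REGISTERED STUB'S `K`-TH CLAUSE IN ONE-TOWER FORM**: the two-run clause of `stub_logComparisonRegPr` (any backgrounds `A₀, A₁`,
constants `κ`, radius `r`, at cut-off `K` and comparison height `n`) holds for run `K+1`'s restricted height density IFF it holds with run `K`'s
tower applied to `1_{histGood K n}·w_K` in its place. [cite: King1986, §3.2 p.656] -/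
theorem stub_clause_iff_oneTower (A₀ A₁ : GaugeField (F.P n) 0 (Matrix.specialUnitaryGroup (Fin 2) ℂ) → ℝ) (κ r : ℝ) :
    (∀ᵐ V ∂fieldMeasure (F.P n) 0 (Matrix.specialUnitaryGroup (Fin 2) ℂ),
      PlaqSmall (θ n) V →
        0 < heightDensity F γ hK (histGood F ℰp θ K n) V →
        0 < heightDensity F γ (hK.trans (Nat.le_succ K)) (histGood F ℰp θ (K + 1) n) V →
          |(Real.log (heightDensity F γ (hK.trans (Nat.le_succ K)) (histGood F ℰp θ (K + 1) n) V) + A₁ V) -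
            (Real.log (heightDensity F γ hK (histGood F ℰp θ K n) V) + A₀ V) - κ| ≤ r) ↔
    (∀ᵐ V ∂fieldMeasure (F.P n) 0 (Matrix.specialUnitaryGroup (Fin 2) ℂ),
      PlaqSmall (θ n) V →
        0 < towerDensity F K ((histGood F ℰp θ K n).indicator (boltzmann (F.P K) ((F.scheme ℰp γ).β K))) (K - n)
          (fieldShift (F.sitesPerDir_eq (m := F.m) (K := K) (j := K - n) (m' := F.m) (K' := n) (j' := 0) (by omega)) V) →
        0 < towerDensity F K ((histGood F ℰp θ K n).indicator (fun U => resDensity F γ (K + 1) {U' | PlaqSmall (θ (K + 1)) U'} 1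
            (fieldShift (F.sitesPerDir_eq (m := F.m) (K := K + 1) (j := 1) (m' := F.m) (K' := K) (j' := 0) (by omega)) U))) (K - n)
          (fieldShift (F.sitesPerDir_eq (m := F.m) (K := K) (j := K - n) (m' := F.m) (K' := n) (j' := 0) (by omega)) V) →
          |(Real.log (towerDensity F K ((histGood F ℰp θ K n).indicator (fun U => resDensity F γ (K + 1) {U' | PlaqSmall (θ (K + 1)) U'} 1
            (fieldShift (F.sitesPerDir_eq (m := F.m) (K := K + 1) (j := 1) (m' := F.m) (K' := K) (j' := 0) (by omega)) U))) (K - n)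
          (fieldShift (F.sitesPerDir_eq (m := F.m) (K := K) (j := K - n) (m' := F.m) (K' := n) (j' := 0) (by omega)) V)) + A₁ V) -
            (Real.log (towerDensity F K ((histGood F ℰp θ K n).indicator (boltzmann (F.P K) ((F.scheme ℰp γ).β K))) (K - n)
          (fieldShift (F.sitesPerDir_eq (m := F.m) (K := K) (j := K - n) (m' := F.m) (K' := n) (j' := 0) (by omega)) V)) +
              A₀ V) - κ| ≤ r) :=
  ae_iff_of_ae_eq (heightDensity_succ_ae_eq F hγ K θ hK)
    (fun V x => PlaqSmall (θ n) V → 0 < heightDensity F γ hK (histGood F ℰp θ K n) V → 0 < x →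
      |(Real.log x + A₁ V) - (Real.log (heightDensity F γ hK (histGood F ℰp θ K n) V) + A₀ V) - κ| ≤ r)

end Main

end Summit.QuantumFields.YangMills.Theorems.LogComparisonOneTower

end
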